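import Summits.Ventures.LatticeQCDFlow.Exactness.IMHCoupledEstimatorStudentised
import HarnessLib

/-!
# Asymptotic coverage of the printed interval: `P(|t_R| ≤ z) → P(|N(0, 1)| ≤ z)` for the studentised coupled flow-MCMC estimator
# (portmanteau on the studentised CLT; the Gaussian law charges no boundary)

HONEST FRAMING: exact (Metropolis-corrected) sampling algorithms for lattice gauge theory;
figures of merit are autocorrelation/cost numbers at stated couplings and volumes; no
continuum-physics claim.

Venture `LatticeQCDFlow` (cell pub-lqcd), topic `Exactness`; FANOUT row 30 (lean-1, GEN-39).  NEW WORK of the cell; sequel to this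
generation's `Exactness/IMHCoupledEstimatorStudentised` (`t_R = (√R)⁻¹(Σ_{j<R} H_k(Z_j) − R·π f)/σ̂_R ⇒ N(0, 1)` for mutually independent pair
streams from ONE initial coupling one update ahead, `Var H_k > 0`).  Convergence in distribution is turned into the statement practitioners
use — the COVERAGE PROBABILITY of the symmetric interval converges to the nominal Gaussian value — by Mathlib's portmanteau theorem
(`ProbabilityMeasure.tendsto_measure_of_null_frontier_of_tendsto'`) and the absence of atoms of the Gaussian law:

* §1 (generic, [ours]) **`gaussianReal_frontier_Icc_eq_zero`** — `N(0,1)(∂[−z, z]) = 0`;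
  **`tendsto_measure_Icc_of_tendstoInDistribution`** — if `T_R ⇒ Y ∼ N(0, 1)` then `P(T_R ∈ [−z, z]) → N(0,1)([−z, z])` (`z ≥ 0`),
  in `ℝ≥0∞` and **`tendsto_measureReal_Icc_of_tendstoInDistribution`** in `ℝ`.
* §2 **`crnLag_untruncated_replicas_coverage`** — THE COVERAGE OF THE STUDENTISED INTERVAL FOR THE EXACTLY UNBIASED COUPLED ESTIMATOR:
  `P(t_R ∈ [−z, z]) → N(0,1)([−z, z])` as `R → ∞`, for every `z ≥ 0`, from every starting law — the interval `H̄_R ± z·σ̂_R/√R` about `π f`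
  has asymptotically its nominal coverage; **`crnLag_replicas_coverage`** — the same for the truncated estimator about its exact mean `m_{k,N}`.
Reading (gauge files): the usual `z`-interval printed from `R` independent coupled pairs of two exact gauge samplers covers the exact
expectation value with probability tending to the Gaussian nominal level.
NOT CLAIMED: any finite-`R` coverage (see `…Hoeffding`, `…BurnInHoeffding`, GEN-38's Chebyshev bars); a rate (Berry–Esseen); the value
`N(0,1)([−z, z])` in closed form; the degenerate case `Var H = 0`.  No `sorry`, no new definitions, nothing cited as a fact.
-/

noncomputable section

namespace Summit.Ventures.LatticeQCDFlow.Exactness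

open MeasureTheory ProbabilityTheory Function Finset Filter
open scoped ENNReal unitInterval Topology NNReal
open Summit.Ventures.LatticeQCDFlow.Scoring

variable {Ω : Type*} [MeasurableSpace Ω] {q : Measure Ω} [IsProbabilityMeasure q] {w : Ω → ℝ}

section Generic

variable {Ω' : Type*} {mΩ' : MeasurableSpace Ω'} {μ : Measure Ω'} [IsProbabilityMeasure μ]
  {Ω'' : Type*} {mΩ'' : MeasurableSpace Ω''} {P' : Measure Ω''} [IsProbabilityMeasure P'] {Y : Ω'' → ℝ}
  {T : ℕ → Ω' → ℝ}

/-! ## §1 Portmanteau for symmetric intervals under a standard normal limit (generic) -/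

omit [IsProbabilityMeasure μ] [IsProbabilityMeasure P'] in
/-- The standard Gaussian law does not charge the boundary of `[−z, z]` (`z ≥ 0`). [ours, bookkeeping] -/
theorem gaussianReal_frontier_Icc_eq_zero {z : ℝ} (hz : 0 ≤ z) : gaussianReal 0 1 (frontier (Set.Icc (-z) z)) = 0 := by
  haveI := nullSingletonClass_gaussianReal (μ := 0) (v := 1) one_ne_zero
  rw [frontier_Icc (by linarith : -z ≤ z)]
  exact (Set.toFinite _).measure_zero _

/-- **PORTMANTEAU FOR A SYMMETRIC INTERVAL**: if `T_R ⇒ Y` with `Y ∼ N(0, 1)`, then `P(T_R ∈ [−z, z]) → N(0,1)([−z, z])` for every `z ≥ 0`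
(extended-real form). [ours — Mathlib's portmanteau theorem applied] -/
theorem tendsto_measure_Icc_of_tendstoInDistribution (h : TendstoInDistribution T atTop Y (fun _ => μ) P')
    (hY : HasLaw Y (gaussianReal 0 1) P') {z : ℝ} (hz : 0 ≤ z) :
    Tendsto (fun R => μ {ω | T R ω ∈ Set.Icc (-z) z}) atTop (𝓝 (gaussianReal 0 1 (Set.Icc (-z) z))) := by
  have hlim : P'.map Y = gaussianReal 0 1 := hY.map_eq
  have hnull : ((⟨P'.map Y, Measure.isProbabilityMeasure_map h.aemeasurable_limit⟩ : ProbabilityMeasure ℝ) : Measure ℝ)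
      (frontier (Set.Icc (-z) z)) = 0 := by
    show (P'.map Y) (frontier (Set.Icc (-z) z)) = 0
    rw [hlim]; exact gaussianReal_frontier_Icc_eq_zero hz
  have key := ProbabilityMeasure.tendsto_measure_of_null_frontier_of_tendsto' h.tendsto hnull
  have hE : MeasurableSet (Set.Icc (-z) z) := measurableSet_Icc
  refine (key.congr fun R => ?_).trans ?_
  · show (μ.map (T R)) (Set.Icc (-z) z) = μ {ω | T R ω ∈ Set.Icc (-z) z}
    rw [Measure.map_apply_of_aemeasurable (h.forall_aemeasurable R) hE]; rfl
  · show Tendsto id (𝓝 ((P'.map Y) (Set.Icc (-z) z))) (𝓝 (gaussianReal 0 1 (Set.Icc (-z) z)))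
    rw [hlim]; exact tendsto_id

/-- **PORTMANTEAU FOR A SYMMETRIC INTERVAL, real form**: `P(T_R ∈ [−z, z]) → N(0,1)([−z, z])` in `ℝ`. [ours] -/
theorem tendsto_measureReal_Icc_of_tendstoInDistribution (h : TendstoInDistribution T atTop Y (fun _ => μ) P')
    (hY : HasLaw Y (gaussianReal 0 1) P') {z : ℝ} (hz : 0 ≤ z) :
    Tendsto (fun R => μ.real {ω | T R ω ∈ Set.Icc (-z) z}) atTop (𝓝 ((gaussianReal 0 1).real (Set.Icc (-z) z))) := by
  have key := tendsto_measure_Icc_of_tendstoInDistribution h hY hz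
  simp only [measureReal_def]
  exact (ENNReal.tendsto_toReal (measure_ne_top _ _)).comp key

end Generic

section Replicas

variable {Ω' : Type*} {mΩ' : MeasurableSpace Ω'} {μ : Measure Ω'} [IsProbabilityMeasure μ]
  {Z : ℕ → Ω' → (ℕ → Ω × Ω)}
  {Ω'' : Type*} {mΩ'' : MeasurableSpace Ω''} {P' : Measure Ω''} [IsProbabilityMeasure P'] {Y : Ω'' → ℝ}

/-! ## §2 Coverage of the studentised interval for the coupled estimator -/

/-- **ASYMPTOTIC COVERAGE FOR THE EXACTLY UNBIASED COUPLED ESTIMATOR**: in the setting of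
`crnLag_untruncated_replicas_studentised_clt` (mutually independent pair streams from ONE initial coupling one update ahead, `a ≤ f ≤ c`,
`Var H_k > 0`, `Y ∼ N(0, Var H_k)`), for every `z ≥ 0` the probability that the t-statistic
`t_R = (√R)⁻¹(Σ_{j<R} H_k(Z_j) − R·π f)/σ̂_R` lies in `[−z, z]` — i.e. that `π f ∈ H̄_R ± z·σ̂_R/√R` — tends to `N(0,1)([−z, z])`. [ours] -/
theorem crnLag_untruncated_replicas_coverage [MeasurableEq Ω] [Fact (Measurable w)] (hw0 : ∀ y, 0 < w y) {x₀ : Ω}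
    (hmax : ∀ y, w y ≤ w x₀) [IsProbabilityMeasure (q.withDensity fun y => ENNReal.ofReal (w y))]
    (Khat : Kernel (Ω × Ω) (Ω × Ω)) [IsMarkovKernel Khat]
    (hK : ∀ z : Ω × Ω, Khat z = (q.prod (volume : Measure unitInterval)).map (fun p : Ω × unitInterval =>
      ((if (p.2 : ℝ) * w z.1 ≤ w p.1 then p.1 else z.1), (if (p.2 : ℝ) * w z.2 ≤ w p.1 then p.1 else z.2))))
    (ν : Measure (Ω × Ω)) [IsProbabilityMeasure ν] (hlag : ν.map Prod.fst = (ν.map Prod.snd).bind (indepMH q w))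
    {f : Ω → ℝ} (hf : Measurable f) {a c : ℝ} (ha : ∀ x, a ≤ f x) (hc : ∀ x, f x ≤ c) (k : ℕ)
    (hZm : ∀ j, Measurable (Z j))
    (hlaw : ∀ j, μ.map (Z j) = Kernel.trajMeasure (X := fun _ : ℕ => Ω × Ω) ν
      (fun n : ℕ => Khat.comap (fun h : (i : ↥(Finset.Iic n)) → Ω × Ω => h ⟨n, Finset.mem_Iic.2 le_rfl⟩)
        (measurable_pi_apply _)))
    (hind : iIndepFun Z μ)
    (hvar : 0 < Var[fun ω => f ((Z 0 ω k).2) + ∑' n, (f ((Z 0 ω (k + n)).1) - f ((Z 0 ω (k + n)).2)); μ])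
    (hY : HasLaw Y (gaussianReal 0
      (Var[fun ω => f ((Z 0 ω k).2) + ∑' n, (f ((Z 0 ω (k + n)).1) - f ((Z 0 ω (k + n)).2)); μ]).toNNReal) P')
    {z : ℝ} (hz : 0 ≤ z) :
    Tendsto (fun R : ℕ => μ.real {ω | (√(R : ℝ))⁻¹ *
        (∑ j ∈ range R, (f ((Z j ω k).2) + ∑' n, (f ((Z j ω (k + n)).1) - f ((Z j ω (k + n)).2))) -
          R * ∫ x, f x ∂(q.withDensity fun y => ENNReal.ofReal (w y))) /
        √((R : ℝ)⁻¹ * ∑ j ∈ range R, (f ((Z j ω k).2) + ∑' n, (f ((Z j ω (k + n)).1) - f ((Z j ω (k + n)).2))) ^ 2 -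
          ((R : ℝ)⁻¹ * ∑ j ∈ range R, (f ((Z j ω k).2) + ∑' n, (f ((Z j ω (k + n)).1) - f ((Z j ω (k + n)).2)))) ^ 2)
        ∈ Set.Icc (-z) z})
      atTop (𝓝 ((gaussianReal 0 1).real (Set.Icc (-z) z))) := by
  obtain ⟨h, hlaw'⟩ := crnLag_untruncated_replicas_studentised_clt hw0 hmax Khat hK ν hlag hf ha hc k hZm hlaw hind hvar hY
  exact tendsto_measureReal_Icc_of_tendstoInDistribution h hlaw' hz

/-- **ASYMPTOTIC COVERAGE FOR THE TRUNCATED COUPLED ESTIMATOR `H_{k,N}`** about its exact mean `m_{k,N} = (ν₂K^{k+N}) f` (no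
`MeasurableEq`, no maximality; `Var H_{k,N} > 0`). [ours] -/
theorem crnLag_replicas_coverage [Fact (Measurable w)] (hw0 : ∀ y, 0 < w y)
    (Khat : Kernel (Ω × Ω) (Ω × Ω)) [IsMarkovKernel Khat]
    (hK : ∀ z : Ω × Ω, Khat z = (q.prod (volume : Measure unitInterval)).map (fun p : Ω × unitInterval =>
      ((if (p.2 : ℝ) * w z.1 ≤ w p.1 then p.1 else z.1), (if (p.2 : ℝ) * w z.2 ≤ w p.1 then p.1 else z.2))))
    (ν : Measure (Ω × Ω)) [IsProbabilityMeasure ν] (hlag : ν.map Prod.fst = (ν.map Prod.snd).bind (indepMH q w))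
    {f : Ω → ℝ} (hf : Measurable f) {a c : ℝ} (ha : ∀ x, a ≤ f x) (hc : ∀ x, f x ≤ c) (k N : ℕ)
    (hZm : ∀ j, Measurable (Z j))
    (hlaw : ∀ j, μ.map (Z j) = Kernel.trajMeasure (X := fun _ : ℕ => Ω × Ω) ν
      (fun n : ℕ => Khat.comap (fun h : (i : ↥(Finset.Iic n)) → Ω × Ω => h ⟨n, Finset.mem_Iic.2 le_rfl⟩)
        (measurable_pi_apply _)))
    (hind : iIndepFun Z μ)
    (hvar : 0 < Var[fun ω => f ((Z 0 ω k).2) + ∑ n ∈ range N, (f ((Z 0 ω (k + n)).1) - f ((Z 0 ω (k + n)).2)); μ])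
    (hY : HasLaw Y (gaussianReal 0
      (Var[fun ω => f ((Z 0 ω k).2) + ∑ n ∈ range N, (f ((Z 0 ω (k + n)).1) - f ((Z 0 ω (k + n)).2)); μ]).toNNReal) P')
    {z : ℝ} (hz : 0 ≤ z) :
    Tendsto (fun R : ℕ => μ.real {ω | (√(R : ℝ))⁻¹ *
        (∑ j ∈ range R, (f ((Z j ω k).2) + ∑ n ∈ range N, (f ((Z j ω (k + n)).1) - f ((Z j ω (k + n)).2))) -
          R * ∫ y, f y ∂((fun m : Measure Ω => m.bind (indepMH q w))^[k + N] (ν.map Prod.snd))) /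
        √((R : ℝ)⁻¹ * ∑ j ∈ range R, (f ((Z j ω k).2) + ∑ n ∈ range N, (f ((Z j ω (k + n)).1) - f ((Z j ω (k + n)).2))) ^ 2 -
          ((R : ℝ)⁻¹ * ∑ j ∈ range R, (f ((Z j ω k).2) + ∑ n ∈ range N, (f ((Z j ω (k + n)).1) - f ((Z j ω (k + n)).2)))) ^ 2)
        ∈ Set.Icc (-z) z})
      atTop (𝓝 ((gaussianReal 0 1).real (Set.Icc (-z) z))) := by
  obtain ⟨h, hlaw'⟩ := crnLag_replicas_studentised_clt hw0 Khat hK ν hlag hf ha hc k N hZm hlaw hind hvar hY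
  exact tendsto_measureReal_Icc_of_tendstoInDistribution h hlaw' hz

end Replicas

end Summit.Ventures.LatticeQCDFlow.Exactness

end
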